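import Summits.QuantumAdvantage.AdviceFreeQNC0.JointResidueElimination
import HarnessLib

/-!
# Cell qa-qnc0 (rung F-Q1, route RingFrame, crux α): joint elimination against the residues of two
# blocks RELATIVE to a dense low-degree set

The induction engine for interior-cluster special cases of the crux α with more than one window:
`jointElimHard_relative` — for every `γ > 0` there are `η, c₀ > 0` and `L₀` such that for blocks
`L, L' ≥ L₀`, degree `d` with `d ≤ c₀√L`, `d ≤ c₀√L'`, every `v, a₀, b₀, a₁, b₁ ∈ lowDeg 𝔽₂ (L+L') d`
with `#{v ≠ 0} ≥ γ·2^{L+L'}` and every decoders `dec₀, dec₁`: on at least `η·2^{L+L'}` points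
`w = x ++ z` OF THE SUPPORT `{v ≠ 0}` both `dec₀(a₀ w, b₀ w) ≡ |x|` and `dec₁(a₁ w, b₁ w) ≡ |z|`
`(mod 3)`.  Proof: as `jointElimHard` (file `JointResidueElimination.lean`) with the fibrewise
first step done by `elimHard_relative` on the dense columns `{x : v(x,z) ≠ 0}` (Markov over `z`),
and the second step by `elimHard_relative` on a dense level set `{v ≠ 0, a₀ = α, b₀ = β}(x, ·)`
of a good row (Markov over `x`).  A Markov-type counting lemma `card_filter_ge_of_sum_ge` is
included.

The cell's statement (prover; with `v = 1` it is `jointElimHard` at the `√`-scale); not in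
print.  WHAT THIS IS NOT: no ring-game statement here; nothing on `LDMAPolylog`, `TRPlus` or α in
general; no separation.

## References

* S. Srinivasan, *A robust version of Hegedűs's lemma, with applications*, TheoretiCS 2 (2023),
  Lemma 3.1 [Srinivasan2023].
-/

noncomputable section

namespace Summit.QuantumAdvantage.AdviceFreeQNC0

open Finset
open Literature.Computability.MetaComplexity Literature.Computability.MetaComplexity.Smolensky
open Literature.Computability.MetaComplexity.Hegedus

/-! ### A Markov-type count -/

/-- **Markov.** If `f i ≤ M` (`M > 0`) for all `i` in a finite type of size `S` and
`Σ f ≥ τ·S·M`, then at least `(τ/2)·S` indices have `f i ≥ (τ/2)·M`. [folklore] -/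
theorem card_filter_ge_of_sum_ge {ι : Type*} [Fintype ι] [DecidableEq ι] (f : ι → ℝ) (M τ : ℝ)
    (hM : 0 < M) (hf : ∀ i, f i ≤ M)
    (hsum : τ * (Fintype.card ι : ℝ) * M ≤ ∑ i, f i) :
    τ / 2 * (Fintype.card ι : ℝ) ≤ ((univ.filter fun i => τ / 2 * M ≤ f i).card : ℝ) := by
  classical
  by_cases hτ : 0 ≤ τ
  · have hsplit : ∑ i, f i = ∑ i ∈ univ.filter (fun i => τ / 2 * M ≤ f i), f i +
        ∑ i ∈ univ.filter (fun i => ¬ τ / 2 * M ≤ f i), f i :=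
      (sum_filter_add_sum_filter_not univ (fun i => τ / 2 * M ≤ f i) f).symm
    have h1 : ∑ i ∈ univ.filter (fun i => τ / 2 * M ≤ f i), f i ≤
        ((univ.filter fun i => τ / 2 * M ≤ f i).card : ℝ) * M := by
      calc ∑ i ∈ univ.filter (fun i => τ / 2 * M ≤ f i), f i
          ≤ ∑ _i ∈ univ.filter (fun i => τ / 2 * M ≤ f i), M := sum_le_sum fun i _ => hf i
        _ = ((univ.filter fun i => τ / 2 * M ≤ f i).card : ℝ) * M := by rw [sum_const, nsmul_eq_mul]
    have h2 : ∑ i ∈ univ.filter (fun i => ¬ τ / 2 * M ≤ f i), f i ≤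
        (Fintype.card ι : ℝ) * (τ / 2 * M) := by
      calc ∑ i ∈ univ.filter (fun i => ¬ τ / 2 * M ≤ f i), f i
          ≤ ∑ _i ∈ univ.filter (fun i => ¬ τ / 2 * M ≤ f i), τ / 2 * M :=
            sum_le_sum fun i hi => le_of_lt (not_le.1 (mem_filter.1 hi).2)
        _ = ((univ.filter (fun i => ¬ τ / 2 * M ≤ f i)).card : ℝ) * (τ / 2 * M) := by
            rw [sum_const, nsmul_eq_mul]
        _ ≤ (Fintype.card ι : ℝ) * (τ / 2 * M) := by
            have hc : ((univ.filter (fun i => ¬ τ / 2 * M ≤ f i)).card : ℝ) ≤ Fintype.card ι := by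
              exact_mod_cast (card_le_card (filter_subset _ _)).trans (card_univ (α := ι)).le
            exact mul_le_mul_of_nonneg_right hc (by positivity)
    have key : τ * (Fintype.card ι : ℝ) * M ≤
        ((univ.filter fun i => τ / 2 * M ≤ f i).card : ℝ) * M + (Fintype.card ι : ℝ) * (τ / 2 * M) := by
      have := hsum; rw [hsplit] at this; linarith
    have key2 : τ / 2 * (Fintype.card ι : ℝ) * M ≤ ((univ.filter fun i => τ / 2 * M ≤ f i).card : ℝ) * M := by
      linarith
    exact le_of_mul_le_mul_right key2 hM
  · push Not at hτ
    have h1 : τ / 2 * (Fintype.card ι : ℝ) ≤ 0 := by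
      have : (0 : ℝ) ≤ (Fintype.card ι : ℝ) := by positivity
      nlinarith
    exact h1.trans (by positivity)

/-! ### Level sets inside a support, second block -/

/-- Over `𝔽₂`: `x + α + 1 ≠ 0 ↔ x = α`. [folklore] -/
private theorem zmod2_add_add_one_ne_zero_iff3 (x α : ZMod 2) : x + α + 1 ≠ 0 ↔ x = α := by
  revert x α; decide

variable {L L' : ℕ}

/-! ### Joint elimination relative to a dense low-degree set -/

/-- **Relative joint elimination hardness (two blocks).**  For every `γ > 0` there are
`η, c₀ > 0` and `L₀` such that for `L, L' ≥ L₀`, `d ≤ c₀√L`, `d ≤ c₀√L'`, every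
`v, a₀, b₀, a₁, b₁ ∈ lowDeg 𝔽₂ (L + L') d` with `#{v ≠ 0} ≥ γ·2^{L+L'}` and every decoders:
`#{w = x ++ z : v w ≠ 0, dec₀(a₀ w, b₀ w) ≡ |x|, dec₁(a₁ w, b₁ w) ≡ |z| (mod 3)} ≥ η·2^{L+L'}`.
(Cell statement; `elimHard_relative` fibrewise on the dense columns, Markov over rows, then
`elimHard_relative` on a dense degree-`3d` level set of a good row.)
[cite: Srinivasan2023, Lemma 3.1] -/
theorem jointElimHard_relative :
    ∀ γ : ℝ, 0 < γ → ∃ η : ℝ, 0 < η ∧ ∃ c₀ : ℝ, 0 < c₀ ∧ ∃ L₀ : ℕ, ∀ L L' : ℕ, L₀ ≤ L → L₀ ≤ L' →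
      ∀ d : ℕ, (d : ℝ) ≤ c₀ * Real.sqrt L → (d : ℝ) ≤ c₀ * Real.sqrt L' →
      ∀ v a₀ b₀ a₁ b₁ : CubeFn (ZMod 2) (L + L'),
        v ∈ lowDeg (ZMod 2) (L + L') d →
        a₀ ∈ lowDeg (ZMod 2) (L + L') d → b₀ ∈ lowDeg (ZMod 2) (L + L') d →
        a₁ ∈ lowDeg (ZMod 2) (L + L') d → b₁ ∈ lowDeg (ZMod 2) (L + L') d →
          ∀ dec₀ dec₁ : ZMod 2 → ZMod 2 → ℕ,
            γ * (2 : ℝ) ^ (L + L') ≤ ((univ.filter fun w : Fin (L + L') → Bool => v w ≠ 0).card : ℝ) →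
            η * (2 : ℝ) ^ (L + L') ≤ ((univ.filter fun w : Fin (L + L') → Bool => v w ≠ 0 ∧
              dec₀ (a₀ w) (b₀ w) % 3 = wt (fun i : Fin L => w (Fin.castAdd L' i)) % 3 ∧
              dec₁ (a₁ w) (b₁ w) % 3 = wt (fun j : Fin L' => w (Fin.natAdd L j)) % 3).card : ℝ) := by
  intro γ hγ
  classical
  obtain ⟨ηA, hηA, cA, hcA, nA, hA⟩ := elimHard_relative (γ / 2) (by positivity)
  set γ₁ := γ / 2 * ηA with hγ₁
  have hγ₁pos : 0 < γ₁ := by positivity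
  obtain ⟨ηB, hηB, cB, hcB, nB, hB⟩ := elimHard_relative (γ₁ / 10) (by positivity)
  refine ⟨γ₁ / 2 * ηB, by positivity, min cA (cB / 3), lt_min hcA (by positivity), max nA nB,
    fun L L' hL hL' d hdL hdL' v a₀ b₀ a₁ b₁ hv ha₀ hb₀ ha₁ hb₁ dec₀ dec₁ hdense => ?_⟩
  have hLnA : nA ≤ L := le_trans (le_max_left _ _) hL
  have hL'nB : nB ≤ L' := le_trans (le_max_right _ _) hL'
  have hdA : (d : ℝ) ≤ cA * Real.sqrt L :=
    hdL.trans (mul_le_mul_of_nonneg_right (min_le_left _ _) (Real.sqrt_nonneg _))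
  have hdB : ((d + (d + d) : ℕ) : ℝ) ≤ cB * Real.sqrt L' := by
    have h1 : (d : ℝ) ≤ cB / 3 * Real.sqrt L' :=
      hdL'.trans (mul_le_mul_of_nonneg_right (min_le_right _ _) (Real.sqrt_nonneg _))
    push_cast; linarith
  -- events
  let EV : (Fin (L + L') → Bool) → Prop := fun w => v w ≠ 0
  let E₀ : (Fin (L + L') → Bool) → Prop := fun w =>
    dec₀ (a₀ w) (b₀ w) % 3 = wt (fun i : Fin L => w (Fin.castAdd L' i)) % 3
  let E₁ : (Fin (L + L') → Bool) → Prop := fun w =>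
    dec₁ (a₁ w) (b₁ w) % 3 = wt (fun j : Fin L' => w (Fin.natAdd L j)) % 3
  -- (1) columns: relative elimination on the dense columns of `{v ≠ 0}`
  let Vc : (Fin L' → Bool) → ℕ := fun z => (univ.filter fun x : Fin L → Bool => EV (Fin.append x z)).card
  have hVc_le : ∀ z, (Vc z : ℝ) ≤ (2 : ℝ) ^ L := by
    intro z
    have : Vc z ≤ (univ : Finset (Fin L → Bool)).card := card_le_card (filter_subset _ _)
    rw [card_univ, Fintype.card_fun, Fintype.card_bool, Fintype.card_fin] at this
    exact_mod_cast this
  have hVc_sum : γ * (Fintype.card (Fin L' → Bool) : ℝ) * (2 : ℝ) ^ L ≤ ∑ z, (Vc z : ℝ) := by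
    have h := card_filter_eq_sum_right EV
    have hc : (Fintype.card (Fin L' → Bool) : ℝ) = (2 : ℝ) ^ L' := by
      rw [Fintype.card_fun, Fintype.card_bool, Fintype.card_fin]; push_cast; ring
    rw [hc]
    calc γ * (2 : ℝ) ^ L' * (2 : ℝ) ^ L = γ * (2 : ℝ) ^ (L + L') := by rw [pow_add]; ring
      _ ≤ ((univ.filter EV).card : ℝ) := hdense
      _ = ∑ z, (Vc z : ℝ) := by rw [h]; push_cast; rfl
  have hGz := card_filter_ge_of_sum_ge (fun z => (Vc z : ℝ)) ((2 : ℝ) ^ L) γ (by positivity)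
    hVc_le hVc_sum
  have hGz' : γ / 2 * (2 : ℝ) ^ L' ≤
      (((univ : Finset (Fin L' → Bool)).filter fun z => γ / 2 * (2 : ℝ) ^ L ≤ (Vc z : ℝ)).card : ℝ) := by
    have hc : (Fintype.card (Fin L' → Bool) : ℝ) = (2 : ℝ) ^ L' := by
      rw [Fintype.card_fun, Fintype.card_bool, Fintype.card_fin]; push_cast; ring
    rw [hc] at hGz; exact hGz
  -- in a good column, `≥ ηA·2^L` points of `{v ≠ 0}` carry the first event
  let A : (Fin L → Bool) → ℕ := fun x =>
    (univ.filter fun z : Fin L' → Bool => EV (Fin.append x z) ∧ E₀ (Fin.append x z)).card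
  have hcol : ∀ z ∈ ((univ : Finset (Fin L' → Bool)).filter
      fun z => γ / 2 * (2 : ℝ) ^ L ≤ (Vc z : ℝ)), ηA * (2 : ℝ) ^ L ≤
      ((univ.filter fun x : Fin L → Bool => EV (Fin.append x z) ∧ E₀ (Fin.append x z)).card : ℝ) := by
    intro z hz
    rw [mem_filter] at hz
    have h := hA L hLnA d hdA (fun x => v (Fin.append x z)) (fun x => a₀ (Fin.append x z))
      (fun x => b₀ (Fin.append x z)) (comp_append_left_mem_lowDeg hv z)
      (comp_append_left_mem_lowDeg ha₀ z) (comp_append_left_mem_lowDeg hb₀ z) dec₀ hz.2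
    have hset : (univ.filter fun x : Fin L → Bool => v (Fin.append x z) ≠ 0 ∧
        dec₀ (a₀ (Fin.append x z)) (b₀ (Fin.append x z)) % 3 = wt x % 3) =
        univ.filter fun x : Fin L → Bool => EV (Fin.append x z) ∧ E₀ (Fin.append x z) := by
      refine filter_congr fun x _ => ?_
      simp only [EV, E₀, left_of_append]
    rw [hset] at h
    exact h
  -- (2) hence `Σ_x A x ≥ γ₁·2^{L+L'}` (swap the fibres)
  have hA_sum : γ₁ * (Fintype.card (Fin L → Bool) : ℝ) * (2 : ℝ) ^ L' ≤ ∑ x, (A x : ℝ) := by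
    have hswap : ((∑ x : Fin L → Bool, A x : ℕ) : ℝ) =
        ∑ z : Fin L' → Bool, ((univ.filter fun x : Fin L → Bool =>
          EV (Fin.append x z) ∧ E₀ (Fin.append x z)).card : ℝ) := by
      have h1 := card_filter_eq_sum_left (fun w => EV w ∧ E₀ w)
      have h2 := card_filter_eq_sum_right (fun w => EV w ∧ E₀ w)
      have : (∑ x : Fin L → Bool, A x) = ∑ z : Fin L' → Bool,
          (univ.filter fun x : Fin L → Bool => EV (Fin.append x z) ∧ E₀ (Fin.append x z)).card := by
        rw [← h1, h2]
      exact_mod_cast this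
    have hc : (Fintype.card (Fin L → Bool) : ℝ) = (2 : ℝ) ^ L := by
      rw [Fintype.card_fun, Fintype.card_bool, Fintype.card_fin]; push_cast; ring
    rw [hc]
    push_cast at hswap ⊢
    rw [hswap]
    calc γ₁ * (2 : ℝ) ^ L * (2 : ℝ) ^ L' = (γ / 2 * (2 : ℝ) ^ L') * (ηA * (2 : ℝ) ^ L) := by
          rw [hγ₁]; ring
      _ ≤ (((univ : Finset (Fin L' → Bool)).filter
            fun z => γ / 2 * (2 : ℝ) ^ L ≤ (Vc z : ℝ)).card : ℝ) * (ηA * (2 : ℝ) ^ L) :=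
          mul_le_mul_of_nonneg_right hGz' (by positivity)
      _ = ∑ _z ∈ ((univ : Finset (Fin L' → Bool)).filter
            fun z => γ / 2 * (2 : ℝ) ^ L ≤ (Vc z : ℝ)), ηA * (2 : ℝ) ^ L := by
          rw [sum_const, nsmul_eq_mul]
      _ ≤ ∑ z ∈ ((univ : Finset (Fin L' → Bool)).filter
            fun z => γ / 2 * (2 : ℝ) ^ L ≤ (Vc z : ℝ)), ((univ.filter fun x : Fin L → Bool =>
            EV (Fin.append x z) ∧ E₀ (Fin.append x z)).card : ℝ) := sum_le_sum hcol
      _ ≤ ∑ z, ((univ.filter fun x : Fin L → Bool =>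
            EV (Fin.append x z) ∧ E₀ (Fin.append x z)).card : ℝ) :=
          sum_le_sum_of_subset_of_nonneg (filter_subset _ _) fun _ _ _ => Nat.cast_nonneg _
  have hA_le : ∀ x, (A x : ℝ) ≤ (2 : ℝ) ^ L' := by
    intro x
    have : A x ≤ (univ : Finset (Fin L' → Bool)).card := card_le_card (filter_subset _ _)
    rw [card_univ, Fintype.card_fun, Fintype.card_bool, Fintype.card_fin] at this
    exact_mod_cast this
  have hGx := card_filter_ge_of_sum_ge (fun x => (A x : ℝ)) ((2 : ℝ) ^ L') γ₁ (by positivity)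
    hA_le hA_sum
  have hGx' : γ₁ / 2 * (2 : ℝ) ^ L ≤
      (((univ : Finset (Fin L → Bool)).filter fun x => γ₁ / 2 * (2 : ℝ) ^ L' ≤ (A x : ℝ)).card : ℝ) := by
    have hc : (Fintype.card (Fin L → Bool) : ℝ) = (2 : ℝ) ^ L := by
      rw [Fintype.card_fun, Fintype.card_bool, Fintype.card_fin]; push_cast; ring
    rw [hc] at hGx; exact hGx
  -- (3) in a good row, a dense level set and the second event
  have hrow : ∀ x ∈ ((univ : Finset (Fin L → Bool)).filter
      fun x => γ₁ / 2 * (2 : ℝ) ^ L' ≤ (A x : ℝ)), ηB * (2 : ℝ) ^ L' ≤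
      ((univ.filter fun z : Fin L' → Bool =>
        EV (Fin.append x z) ∧ E₀ (Fin.append x z) ∧ E₁ (Fin.append x z)).card : ℝ) := by
    intro x hx
    rw [mem_filter] at hx
    have hAx := hx.2
    -- `A x` is a sum over the level sets of `(a₀, b₀)(x, ·)` named `r` by `dec₀`
    have hAeq : A x = ∑ p ∈ (univ : Finset (ZMod 2 × ZMod 2)).filter (fun p => dec₀ p.1 p.2 % 3 = wt x % 3),
        (univ.filter fun z : Fin L' → Bool => v (Fin.append x z) ≠ 0 ∧
          a₀ (Fin.append x z) = p.1 ∧ b₀ (Fin.append x z) = p.2).card := by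
      have h := card_eq_sum_card_fiberwise
        (s := univ.filter fun z : Fin L' → Bool => EV (Fin.append x z) ∧ E₀ (Fin.append x z))
        (t := (univ : Finset (ZMod 2 × ZMod 2)).filter fun p => dec₀ p.1 p.2 % 3 = wt x % 3)
        (f := fun z => (a₀ (Fin.append x z), b₀ (Fin.append x z))) (fun z hz => by
          rw [Finset.mem_coe, mem_filter] at hz
          rw [Finset.mem_coe, mem_filter]
          refine ⟨mem_univ _, ?_⟩
          have := hz.2.2
          simp only [E₀, left_of_append] at this
          exact this)
      change (univ.filter fun z : Fin L' → Bool => EV (Fin.append x z) ∧ E₀ (Fin.append x z)).card = _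
      rw [h]
      refine sum_congr rfl fun p hp => ?_
      rw [mem_filter] at hp
      congr 1
      ext z
      simp only [mem_filter, mem_univ, true_and, Prod.ext_iff, EV, E₀, left_of_append]
      constructor
      · rintro ⟨⟨hvz, -⟩, h1, h2⟩; exact ⟨hvz, h1, h2⟩
      · rintro ⟨hvz, h1, h2⟩; refine ⟨⟨hvz, ?_⟩, h1, h2⟩; rw [h1, h2]; exact hp.2
    have hbig : ∃ p : ZMod 2 × ZMod 2, dec₀ p.1 p.2 % 3 = wt x % 3 ∧ γ₁ / 10 * (2 : ℝ) ^ L' ≤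
        ((univ.filter fun z : Fin L' → Bool => v (Fin.append x z) ≠ 0 ∧
          a₀ (Fin.append x z) = p.1 ∧ b₀ (Fin.append x z) = p.2).card : ℝ) := by
      by_contra hno
      push Not at hno
      have hle : (A x : ℝ) ≤ ∑ _p ∈ (univ : Finset (ZMod 2 × ZMod 2)).filter
          (fun p => dec₀ p.1 p.2 % 3 = wt x % 3), γ₁ / 10 * (2 : ℝ) ^ L' := by
        rw [hAeq]; push_cast
        exact sum_le_sum fun p hp => le_of_lt (hno p (mem_filter.1 hp).2)
      rw [sum_const, nsmul_eq_mul] at hle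
      have hc4 : (((univ : Finset (ZMod 2 × ZMod 2)).filter (fun p => dec₀ p.1 p.2 % 3 = wt x % 3)).card : ℝ)
          ≤ 4 := by
        have : ((univ : Finset (ZMod 2 × ZMod 2)).filter (fun p => dec₀ p.1 p.2 % 3 = wt x % 3)).card ≤
            (univ : Finset (ZMod 2 × ZMod 2)).card := card_le_card (filter_subset _ _)
        have h4 : (univ : Finset (ZMod 2 × ZMod 2)).card = 4 := by simp
        rw [h4] at this; exact_mod_cast this
      have hmul : (((univ : Finset (ZMod 2 × ZMod 2)).filter (fun p => dec₀ p.1 p.2 % 3 = wt x % 3)).card : ℝ)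
          * (γ₁ / 10 * (2 : ℝ) ^ L') ≤ 4 * (γ₁ / 10 * (2 : ℝ) ^ L') :=
        mul_le_mul_of_nonneg_right hc4 (by positivity)
      have hpos : (0 : ℝ) < γ₁ * (2 : ℝ) ^ L' := by positivity
      linarith
    obtain ⟨⟨α, β⟩, hpr, hdenseL⟩ := hbig
    -- the level set as the support of a degree-`3d` polynomial on the second block
    have hconst : ∀ c : ZMod 2, (fun _ : Fin L' → Bool => c) ∈ lowDeg (ZMod 2) L' d := by
      intro c
      have h1 : (1 : CubeFn (ZMod 2) L') ∈ lowDeg (ZMod 2) L' d := by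
        rw [← mono_empty]; exact mono_mem_lowDeg (by simp)
      have : (fun _ : Fin L' → Bool => c) = c • (1 : CubeFn (ZMod 2) L') := by funext u; simp
      rw [this]; exact Submodule.smul_mem _ c h1
    set vx : CubeFn (ZMod 2) L' := (fun z => v (Fin.append x z)) *
      (((fun z => a₀ (Fin.append x z)) + (fun _ => α + 1)) *
        ((fun z => b₀ (Fin.append x z)) + (fun _ => β + 1))) with hvx
    have hvx_deg : vx ∈ lowDeg (ZMod 2) L' (d + (d + d)) :=
      mul_mem_lowDeg_add (comp_append_right_mem_lowDeg hv x)
        (mul_mem_lowDeg_add (Submodule.add_mem _ (comp_append_right_mem_lowDeg ha₀ x) (hconst _))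
          (Submodule.add_mem _ (comp_append_right_mem_lowDeg hb₀ x) (hconst _)))
    have hvx_iff : ∀ z, vx z ≠ 0 ↔ v (Fin.append x z) ≠ 0 ∧
        a₀ (Fin.append x z) = α ∧ b₀ (Fin.append x z) = β := by
      intro z
      simp only [hvx, Pi.mul_apply, Pi.add_apply, mul_ne_zero_iff]
      rw [← add_assoc, ← add_assoc, zmod2_add_add_one_ne_zero_iff3, zmod2_add_add_one_ne_zero_iff3]
    have ha₁x : (fun z => a₁ (Fin.append x z)) ∈ lowDeg (ZMod 2) L' (d + (d + d)) :=
      lowDeg_mono (by omega) (comp_append_right_mem_lowDeg ha₁ x)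
    have hb₁x : (fun z => b₁ (Fin.append x z)) ∈ lowDeg (ZMod 2) L' (d + (d + d)) :=
      lowDeg_mono (by omega) (comp_append_right_mem_lowDeg hb₁ x)
    have hsupp : (univ.filter fun z : Fin L' → Bool => vx z ≠ 0) =
        univ.filter fun z : Fin L' → Bool => v (Fin.append x z) ≠ 0 ∧
          a₀ (Fin.append x z) = α ∧ b₀ (Fin.append x z) = β :=
      filter_congr fun z _ => hvx_iff z
    have hrel := hB L' hL'nB (d + (d + d)) hdB vx _ _ hvx_deg ha₁x hb₁x dec₁
      (by rw [hsupp]; exact hdenseL)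
    refine hrel.trans ?_
    have hsub : (univ.filter fun z : Fin L' → Bool => vx z ≠ 0 ∧
        dec₁ (a₁ (Fin.append x z)) (b₁ (Fin.append x z)) % 3 = wt z % 3) ⊆
        univ.filter fun z : Fin L' → Bool =>
          EV (Fin.append x z) ∧ E₀ (Fin.append x z) ∧ E₁ (Fin.append x z) := by
      intro z hz
      rw [mem_filter] at hz ⊢
      obtain ⟨hvz, hα, hβ⟩ := (hvx_iff z).1 hz.2.1
      refine ⟨mem_univ _, hvz, ?_, ?_⟩
      · simp only [E₀, left_of_append]; rw [hα, hβ]; exact hpr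
      · simp only [E₁, right_of_append]; exact hz.2.2
    exact_mod_cast card_le_card hsub
  -- (4) sum over the good rows
  have htot : ((univ.filter fun w : Fin (L + L') → Bool => EV w ∧ E₀ w ∧ E₁ w).card : ℝ) =
      ∑ x : Fin L → Bool, ((univ.filter fun z : Fin L' → Bool =>
        EV (Fin.append x z) ∧ E₀ (Fin.append x z) ∧ E₁ (Fin.append x z)).card : ℝ) := by
    rw [card_filter_eq_sum_left (fun w => EV w ∧ E₀ w ∧ E₁ w)]; push_cast; rfl
  change γ₁ / 2 * ηB * (2 : ℝ) ^ (L + L') ≤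
    ((univ.filter fun w : Fin (L + L') → Bool => EV w ∧ E₀ w ∧ E₁ w).card : ℝ)
  rw [htot]
  calc γ₁ / 2 * ηB * (2 : ℝ) ^ (L + L') = (γ₁ / 2 * (2 : ℝ) ^ L) * (ηB * (2 : ℝ) ^ L') := by
        rw [pow_add]; ring
    _ ≤ (((univ : Finset (Fin L → Bool)).filter
          fun x => γ₁ / 2 * (2 : ℝ) ^ L' ≤ (A x : ℝ)).card : ℝ) * (ηB * (2 : ℝ) ^ L') :=
        mul_le_mul_of_nonneg_right hGx' (by positivity)
    _ = ∑ _x ∈ ((univ : Finset (Fin L → Bool)).filter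
          fun x => γ₁ / 2 * (2 : ℝ) ^ L' ≤ (A x : ℝ)), ηB * (2 : ℝ) ^ L' := by
        rw [sum_const, nsmul_eq_mul]
    _ ≤ ∑ x ∈ ((univ : Finset (Fin L → Bool)).filter
          fun x => γ₁ / 2 * (2 : ℝ) ^ L' ≤ (A x : ℝ)), ((univ.filter fun z : Fin L' → Bool =>
          EV (Fin.append x z) ∧ E₀ (Fin.append x z) ∧ E₁ (Fin.append x z)).card : ℝ) :=
        sum_le_sum hrow
    _ ≤ ∑ x : Fin L → Bool, ((univ.filter fun z : Fin L' → Bool =>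
          EV (Fin.append x z) ∧ E₀ (Fin.append x z) ∧ E₁ (Fin.append x z)).card : ℝ) :=
        sum_le_sum_of_subset_of_nonneg (filter_subset _ _) fun _ _ _ => Nat.cast_nonneg _

end Summit.QuantumAdvantage.AdviceFreeQNC0
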